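import Summits.QuantumFields.YangMills.Theses.ComplexCouplingChannel
import Literature.MathematicalPhysics.QuantumFieldTheory.PeriodicBoxPartitionFunction
import Literature.Analysis.Complex.HarnackHalfPlane
import Summits.QuantumFields.YangMills.Theorems.ComplexCouplingChannelTubeZeroFreeChannelStubDominanceOfZeroFree

/-!
# Line `FluxPinchSketch` — stub-form skeleton (crux `TubeZeroFreeChannel`, stmt-QuantumFields-18841)

Lead: prover-line-stmt-QuantumFields-18841-a1-0 (2026-08-17), reshaping the ideator's
`FluxPinchSketch.lean` (card `flux-vacua-harnack-pinch`, negation lens) into REGISTERED STUB form.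
This is a REFUTATION line: its composition `TubeZeroFreeChannel_refuted_of` concludes
`¬ TubeZeroFreeChannel` BY NAME, modulo exactly the two `stub_*` theorems below (the only `sorry`s).

Mechanism.  For an admissible `(G, r)` with near-degenerate 't Hooft-flux vacua whose splitting
`g_L` has TWO RATES (`Re g_L(x) / Re g_L(β) → 0` as `L → ∞` at a real `x` near `β`), Harnack's
inequality (`exists_re_nonpos_of_twoRate`, PROVED) forces `Re g_L ≤ 0` somewhere in every disc
about `β` for cofinally many `L`: the vacuum level `λ₀ = λ_{j₀} e^{g_L}` is no longer strictly
dominant there.  On the other hand, if the crux held, the disc would be uniformly zero-free for the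
tubes, and the ANALYTIC STUB `stub_dominance_of_zeroFree` (Vitali / Borel–Carathéodory / identity
theorem; the converse half of Beraha–Kahane–Weiss) says that zero-freeness of a dominated
exponential sum `Σ n_j λ_j^t + O((θΛ)^t)` for all large `t` forces the level dominant at the centre
to dominate on the WHOLE disc; with the loss of strict dominance and the maximum modulus principle
(`norm_eq_const_mul_of_dominated_touch`, PROVED) two levels become proportional — excluded.  Hence
`PinchedAxis G r`, and `not_tubeZeroFreeChannel_of_pinchedAxis` (PROVED) refutes the crux.

Stubs (registered with `ledger skeleton check`):
* `stub_dominance_of_zeroFree` — PURE complex analysis (no gauge theory), worker — LANDED p151004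
  (`Theorems/ComplexCouplingChannelTubeZeroFreeChannelStubDominanceOfZeroFree.lean`, with the
  Literature prelims p150139 `Literature/Analysis/Complex/ExponentialSumDominance.lean`); the stub
  below is now its one-line invocation (no sorry);
* `stub_fluxVacuaTwoRate` — the physics (intended instance `(SO(3), r)`), lead — OPEN (the only sorry).
Everything else is proved.  Vocabulary: the stubs speak `(boxSystem r.ρ ![L,L,L,t]).partZ univ z`
(Literature), the glue converts with the dictionary `Zc_eq_partZ`.
-/

set_option autoImplicit false

noncomputable section

namespace Summit.QuantumFields.YangMills.Cruxes.TubeZeroFreeChannel.FluxPinch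

open scoped BigOperators Topology
open MeasureTheory Filter Metric
open Literature.MathematicalPhysics.QuantumFieldTheory (LatticeRep IsCompactSimpleLieGroup
  haarProbability boxSystem boxSystem_partZ_univ_eq_finTorus boxSystem_regular)
open Literature.MathematicalPhysics.QuantumFieldTheory.PlaqSystem (differentiable_partZ)
open Summit.QuantumFields.YangMills.Theses.ComplexCouplingChannel (TubeZeroFreeChannel)

/-! ## The two stubs -/

/-- STUB A (worker) `stub_dominance_of_zeroFree` — pure complex analysis, the converse half of the
Beraha–Kahane–Weiss mechanism in multi-level form.  On the disc `ball c R` let `Z t` (`t ≥ t₀`)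
be holomorphic functions approximated by a dominated exponential sum: `k + 2` holomorphic
zero-free levels `lam j` with positive integer multiplicities `n j`, envelope `Λ = max_j ‖lam j‖`
(given as `Λ` with the two envelope hypotheses), remainder `‖Z t − Σ n_j lam_j^t‖ ≤ C (θΛ)^t`,
`θ < 1`, no two levels with moduli in a constant ratio, and level `0` strictly dominant at the
centre.  IF every `Z t`, `t ≥ t₀`, is zero-free on the disc, THEN level `0` dominates every level
on the whole disc.  (Proof route: holomorphic logarithms `Z t = exp G_t`, `F_t = G_t / t` has
`Re F_t ≤ log Λ + O(1/t)` and converges near `c` to a logarithm of `lam 0`; Borel–Carathéodory +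
Vitali give a holomorphic limit `F` on the disc with `Re F = log Λ` on the dense open set where one
level strictly dominates, hence everywhere; `F − log lam 0` vanishes near `c`, so by the identity
theorem `log Λ = log ‖lam 0‖` on the disc.) -/
theorem stub_dominance_of_zeroFree :
    ∀ (Z : ℕ → ℂ → ℂ) (c : ℂ) (R : ℝ) (k : ℕ) (lam : Fin (k + 2) → ℂ → ℂ) (n : Fin (k + 2) → ℕ)
      (Λ : ℂ → ℝ) (C θ : ℝ) (t₀ : ℕ),
      0 < R → (∀ j, 0 < n j) → 0 ≤ C → 0 ≤ θ → θ < 1 →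
      (∀ t, t₀ ≤ t → DifferentiableOn ℂ (Z t) (ball c R)) →
      (∀ j, DifferentiableOn ℂ (lam j) (ball c R)) →
      (∀ j, ∀ z ∈ ball c R, lam j z ≠ 0 ∧ ‖lam j z‖ ≤ Λ z) →
      (∀ z ∈ ball c R, ∃ j, ‖lam j z‖ = Λ z) →
      (∀ i j, i ≠ j → ¬ ∃ a : ℝ, ∀ z ∈ ball c R, ‖lam i z‖ = a * ‖lam j z‖) →
      (∀ z ∈ ball c R, ∀ t : ℕ, t₀ ≤ t →
        ‖Z t z - ∑ j, (n j : ℂ) * (lam j z) ^ t‖ ≤ C * (θ * Λ z) ^ t) →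
      (∀ j, j ≠ 0 → ‖lam j c‖ < ‖lam 0 c‖) →
      (∀ t, t₀ ≤ t → ∀ z ∈ ball c R, Z t z ≠ 0) →
      ∀ j, ∀ z ∈ ball c R, ‖lam j z‖ ≤ ‖lam 0 z‖ :=
  -- STUB A LANDED (worker, p151004): the tree theorem, verbatim signature
  Summit.QuantumFields.YangMills.Theorems.TubeZeroFreeChannel.stub_dominance_of_zeroFree

/-- STUB P (lead) `stub_fluxVacuaTwoRate` — the physics (near-degenerate 't Hooft-flux vacua with a
two-rate splitting; intended instance `(SO(3), r)`, more generally compact simple `G` with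
`π₁(G) ≠ 0`).  For SOME admissible `(G, r)`, cofinally in `β` and for every `δ > 0`: a radius
`R ≤ δ`, a real point `x` with `|x − β| < R/2`, a number of levels, multiplicities, a flux index
`j₀ ≠ 0` and, for all large `L`, holomorphic zero-free levels `lam L j` on `ball β R` with envelope
`Λ L`, pairwise non-proportional moduli, dominating the tube partition functions
`(boxSystem r.ρ ![L,L,L,t]).partZ univ` for all `t ≥ 1` up to `C_L (θ_L Λ L)^t` (`θ_L < 1`), the
vacuum `lam L 0` strictly top at `β` and equal to `lam L j₀ · exp (g L)` with `g L` holomorphic,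
`Re g L β > 0`; and the TWO-RATE property `Re g L x / Re g L β → 0` (`L → ∞`) — the typed form of
`ΔE_m(β, L) ≍ L e^{−ρ(β)L²}` (confinement) or `≍ e^{−M(β)L}` (ℤ₂-monopole tunnelling) with `ρ`
(resp. `M`) strictly monotone in `β`. -/
theorem stub_fluxVacuaTwoRate :
    ∃ (G : Type) (_ : Group G) (_ : TopologicalSpace G) (_ : IsTopologicalGroup G)
      (_ : CompactSpace G) (_ : MeasurableSpace G) (_ : BorelSpace G),
      IsCompactSimpleLieGroup G ∧ ∃ r : LatticeRep G, ∀ b : ℝ, ∃ β : ℝ, b ≤ β ∧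
        ∀ δ : ℝ, 0 < δ → ∃ (R x : ℝ) (k : ℕ) (n : Fin (k + 2) → ℕ) (j₀ : Fin (k + 2))
          (lam : ℕ → Fin (k + 2) → ℂ → ℂ) (Λ : ℕ → ℂ → ℝ) (g : ℕ → ℂ → ℂ) (L₀ : ℕ),
          0 < R ∧ R ≤ δ ∧ |x - β| < R / 2 ∧ (∀ j, 0 < n j) ∧ j₀ ≠ 0 ∧
          (∀ L : ℕ, L₀ ≤ L →
            (∀ j, DifferentiableOn ℂ (lam L j) (ball (β : ℂ) R)) ∧
            (∀ j, ∀ z ∈ ball (β : ℂ) R, lam L j z ≠ 0 ∧ ‖lam L j z‖ ≤ Λ L z) ∧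
            (∀ z ∈ ball (β : ℂ) R, ∃ j, ‖lam L j z‖ = Λ L z) ∧
            (∀ i j, i ≠ j → ¬ ∃ a : ℝ, ∀ z ∈ ball (β : ℂ) R, ‖lam L i z‖ = a * ‖lam L j z‖) ∧
            (∃ C θ : ℝ, 0 ≤ C ∧ 0 ≤ θ ∧ θ < 1 ∧ ∀ z ∈ ball (β : ℂ) R, ∀ t : ℕ, 1 ≤ t →
              ‖(boxSystem r.ρ (![L, L, L, t] : Fin 4 → ℕ)).partZ Finset.univ z
                - ∑ j, (n j : ℂ) * (lam L j z) ^ t‖ ≤ C * (θ * Λ L z) ^ t) ∧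
            (∀ j, j ≠ 0 → ‖lam L j (β : ℂ)‖ < ‖lam L 0 (β : ℂ)‖) ∧
            DifferentiableOn ℂ (g L) (ball (β : ℂ) R) ∧ 0 < (g L (β : ℂ)).re ∧
            (∀ z ∈ ball (β : ℂ) R, lam L 0 z = lam L j₀ z * Complex.exp (g L z))) ∧
          Tendsto (fun L => (g L x).re / (g L β).re) atTop (𝓝 0) := by
  sorry

/-! ## Named definitions (verbatim the ideator's / strategist's) and the dictionary with `partZ` -/

section Defs

variable (G : Type) [Group G] [TopologicalSpace G] [IsTopologicalGroup G] [CompactSpace G]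
  [MeasurableSpace G] [BorelSpace G]

/-- The complex-coupling Wilson partition function of the periodic box `a³ × t` in the
representation `r` — verbatim the `let Zc` of the route decl `TubeZeroFreeChannel`. -/
def Zc (r : LatticeRep G) (z : ℂ) (a t : ℕ) : ℂ :=
  let St := Fin a × Fin a × Fin a × Fin t
  let sh : St → Fin 4 → St := fun x μ => ![(finRotate a x.1, x.2.1, x.2.2.1, x.2.2.2),
    (x.1, finRotate a x.2.1, x.2.2.1, x.2.2.2), (x.1, x.2.1, finRotate a x.2.2.1, x.2.2.2),
    (x.1, x.2.1, x.2.2.1, finRotate t x.2.2.2)] μ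
  let pl : (St × Fin 4 → G) → St → Fin 4 → Fin 4 → G := fun U x μ ν =>
    U (x, μ) * U (sh x μ, ν) * (U (sh x ν, μ))⁻¹ * (U (x, ν))⁻¹
  ∫ U, Complex.exp (-(z * ((∑ x : St, ∑ q : {q : Fin 4 × Fin 4 // q.1 < q.2},
    ((r.N : ℝ) - (r.ρ (pl U x q.1.1 q.1.2)).trace.re) : ℝ) : ℂ)))
    ∂(Measure.pi fun _ : St × Fin 4 => haarProbability G)

/-- DICTIONARY: the inline `Zc` is the Literature box partition function
`(boxSystem r.ρ ![a, a, a, t]).partZ univ z` (`boxSystem_partZ_univ_eq_finTorus`). -/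
theorem Zc_eq_partZ (r : LatticeRep G) (z : ℂ) (a t : ℕ) :
    Zc G r z a t = (boxSystem r.ρ (![a, a, a, t] : Fin 4 → ℕ)).partZ Finset.univ z :=
  (boxSystem_partZ_univ_eq_finTorus r.ρ r.continuous a a a t z).symm

/-- Uniform tube zero-freeness on `D` (cross-section floor `L₀`, then a length floor `t₀(L)`). -/
def UniformZeroFreeOn (r : LatticeRep G) (D : Set ℂ) : Prop :=
  ∃ L₀ : ℕ, ∀ L : ℕ, L₀ ≤ L → ∃ t₀ : ℕ, ∀ t : ℕ, t₀ ≤ t → ∀ z ∈ D, Zc G r z L t ≠ 0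

/-- The axis point `β` is PINCHED for `(G, r)`: no disc about `β` is uniformly zero-free
(tube zeros come arbitrarily close to `β` for cofinally many cross-sections `L`, lengths `t`). -/
def PinchedAt (r : LatticeRep G) (β : ℝ) : Prop :=
  ∀ δ : ℝ, 0 < δ → ¬ UniformZeroFreeOn G r (ball (β : ℂ) δ)

/-- The weak-coupling axis is pinched cofinally. -/
def PinchedAxis (r : LatticeRep G) : Prop :=
  ∀ b : ℝ, ∃ β : ℝ, b ≤ β ∧ PinchedAt G r β

variable {G}

/-- Uniform zero-freeness passes to subsets. -/
theorem uniformZeroFreeOn_mono (r : LatticeRep G) {D₁ D₂ : Set ℂ} (h : D₁ ⊆ D₂)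
    (h₂ : UniformZeroFreeOn G r D₂) : UniformZeroFreeOn G r D₁ := by
  obtain ⟨L₀, hL₀⟩ := h₂
  refine ⟨L₀, fun L hL => ?_⟩
  obtain ⟨t₀, ht₀⟩ := hL₀ L hL
  exact ⟨t₀, fun t ht z hz => ht₀ t ht z (h hz)⟩

/-- The box partition functions are entire in the coupling (Literature `differentiable_partZ`). -/
theorem differentiable_partZ_box (r : LatticeRep G) (L t : ℕ) :
    Differentiable ℂ ((boxSystem r.ρ (![L, L, L, t] : Fin 4 → ℕ)).partZ Finset.univ) :=
  differentiable_partZ (boxSystem_regular r.ρ r.continuous _) _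

end Defs

/-- The crux over the named definitions. -/
def CruxBody : Prop :=
  ∀ (G : Type) [Group G] [TopologicalSpace G] [IsTopologicalGroup G] [CompactSpace G]
    [MeasurableSpace G] [BorelSpace G], IsCompactSimpleLieGroup G → ∀ r : LatticeRep G,
    ∃ β₁ : ℝ, ∀ β : ℝ, β₁ ≤ β → ∀ ρ : ℝ, 0 < ρ → ∃ D : Set ℂ, IsOpen D ∧ IsConnected D ∧
      (β : ℂ) ∈ D ∧ (∃ x : ℝ, |x| < ρ ∧ (x : ℂ) ∈ D) ∧ UniformZeroFreeOn G r D

/-- The route decl IS `CruxBody`, definitionally. -/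
theorem tubeZeroFreeChannel_iff : TubeZeroFreeChannel ↔ CruxBody := Iff.rfl

/-! ## Typed obstruction and its glue (proved) -/

/-- A cofinally pinched admissible `(G, r)` refutes the crux: the crux's open `D ∋ β` contains a
disc about `β`, which would be uniformly zero-free. -/
theorem not_tubeZeroFreeChannel_of_pinchedAxis (G : Type) [Group G] [TopologicalSpace G]
    [IsTopologicalGroup G] [CompactSpace G] [MeasurableSpace G] [BorelSpace G]
    (hG : IsCompactSimpleLieGroup G) (r : LatticeRep G) (h : PinchedAxis G r) :
    ¬ TubeZeroFreeChannel := by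
  intro hT
  rw [tubeZeroFreeChannel_iff] at hT
  obtain ⟨β₁, hβ₁⟩ := hT G hG r
  obtain ⟨β, hb, hP⟩ := h β₁
  obtain ⟨D, hDo, -, hβD, -, hU⟩ := hβ₁ β hb 1 one_pos
  obtain ⟨δ, hδ, hball⟩ := Metric.isOpen_iff.mp hDo _ hβD
  exact hP δ hδ (uniformZeroFreeOn_mono r hball hU)

/-! ## The Harnack two-rate pinch (proved)

If holomorphic functions `g_L` on the disc `B(β, R)` have `Re g_L(β) > 0` but the ratio
`Re g_L(x) / Re g_L(β)` at a fixed real point `x` with `|x - β| < R/2` tends to `0` along `L`,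
then `Re g_L` cannot stay positive on the disc for all large `L`: Harnack's inequality for the
half-plane-valued map `i·g_L` would give `Re g_L(x) ≥ Re g_L(β)/3`. -/
theorem exists_re_nonpos_of_twoRate {g : ℕ → ℂ → ℂ} {β x R : ℝ} (hR : 0 < R)
    (hx : |x - β| < R / 2)
    (hd : ∀ᶠ L in atTop, DifferentiableOn ℂ (g L) (ball (β : ℂ) R))
    (hpos : ∀ᶠ L in atTop, 0 < (g L β).re)
    (hrate : Tendsto (fun L => (g L x).re / (g L β).re) atTop (𝓝 0)) :
    ∃ᶠ L in atTop, ∃ z ∈ ball (β : ℂ) R, (g L z).re ≤ 0 := by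
  by_contra hcontra
  rw [Filter.not_frequently] at hcontra
  have hsmall : ∀ᶠ L in atTop, (g L x).re / (g L β).re < 1 / 3 :=
    hrate.eventually (gt_mem_nhds (by norm_num))
  obtain ⟨L, hL4⟩ := (((hd.and hpos).and hcontra).and hsmall).exists
  obtain ⟨⟨⟨hdL, hposL⟩, hcL⟩, hsL⟩ := hL4
  -- positivity of `Re g_L` on the whole disc
  have hposall : ∀ z ∈ ball (β : ℂ) R, 0 < (g L z).re := by
    intro z hz
    by_contra hle
    exact hcL ⟨z, hz, not_lt.mp hle⟩
  -- Harnack for `Q = I * g L` (`im Q = re g`)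
  set Q : ℂ → ℂ := fun z => Complex.I * g L z with hQ
  have hQd : DifferentiableOn ℂ Q (ball (β : ℂ) R) := hdL.const_mul Complex.I
  have hQim : ∀ z, (Q z).im = (g L z).re := by
    intro z; simp [hQ, Complex.mul_im]
  have hQpos : ∀ z ∈ ball (β : ℂ) R, 0 < (Q z).im := fun z hz => by
    rw [hQim]; exact hposall z hz
  have hxball : (x : ℂ) ∈ ball (β : ℂ) R := by
    rw [Metric.mem_ball, dist_eq_norm, ← Complex.ofReal_sub, Complex.norm_real, Real.norm_eq_abs]
    linarith
  have hH := Complex.im_apply_ge_harnack hR hQd hQpos hxball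
  rw [hQim, hQim] at hH
  -- the Harnack factor at distance `< R/2` is at least `1/3`
  have hdist : ‖(x : ℂ) - β‖ < R / 2 := by
    rw [← Complex.ofReal_sub, Complex.norm_real, Real.norm_eq_abs]; exact hx
  have hfac : (1 : ℝ) / 3 ≤ (R - ‖(x : ℂ) - (β : ℂ)‖) / (R + ‖(x : ℂ) - (β : ℂ)‖) := by
    have hn : 0 ≤ ‖(x : ℂ) - (β : ℂ)‖ := norm_nonneg _
    rw [div_le_div_iff₀ (by norm_num) (by linarith)]
    linarith
  have hβpos : 0 < (g L (β : ℂ)).re := hposL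
  have hge : (g L (β : ℂ)).re / 3 ≤ (g L (x : ℂ)).re := by
    calc (g L (β : ℂ)).re / 3 = (g L (β : ℂ)).re * (1 / 3) := by ring
      _ ≤ (g L (β : ℂ)).re * ((R - ‖(x : ℂ) - (β : ℂ)‖) / (R + ‖(x : ℂ) - (β : ℂ)‖)) :=
          mul_le_mul_of_nonneg_left hfac hβpos.le
      _ ≤ (g L (x : ℂ)).re := hH
  have hratio : (1 : ℝ) / 3 ≤ (g L x).re / (g L β).re := by
    rw [le_div_iff₀ hβpos]
    linarith
  linarith

/-! ## Maximum modulus: domination plus one touching point makes two levels proportional (proved) -/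

/-- If `l₁` is dominated by the zero-free `l₀` on a ball and touches it in modulus at one interior
point, then `‖l₁‖ = 1 · ‖l₀‖` on the whole ball (maximum modulus principle for `l₁ / l₀`). -/
theorem norm_eq_const_mul_of_dominated_touch {l₀ l₁ : ℂ → ℂ} {c z₀ : ℂ} {R : ℝ}
    (h₀ : DifferentiableOn ℂ l₀ (ball c R)) (h₁ : DifferentiableOn ℂ l₁ (ball c R))
    (hne : ∀ z ∈ ball c R, l₀ z ≠ 0) (hdom : ∀ z ∈ ball c R, ‖l₁ z‖ ≤ ‖l₀ z‖)
    (hz₀ : z₀ ∈ ball c R) (htouch : ‖l₀ z₀‖ ≤ ‖l₁ z₀‖) :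
    ∃ a : ℝ, ∀ z ∈ ball c R, ‖l₁ z‖ = a * ‖l₀ z‖ := by
  set φ : ℂ → ℂ := fun z => l₁ z / l₀ z with hφ
  have hφd : DifferentiableOn ℂ φ (ball c R) := h₁.div h₀ hne
  have hφle : ∀ z ∈ ball c R, ‖φ z‖ ≤ 1 := fun z hz => by
    rw [hφ, norm_div, div_le_one (norm_pos_iff.2 (hne z hz))]
    exact hdom z hz
  have hφz₀ : ‖φ z₀‖ = 1 := by
    refine le_antisymm (hφle z₀ hz₀) ?_
    rw [hφ, norm_div, le_div_iff₀ (norm_pos_iff.2 (hne z₀ hz₀)), one_mul]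
    exact htouch
  have hmax : IsMaxOn (norm ∘ φ) (ball c R) z₀ := fun z hz => by
    simp only [Function.comp_apply, Set.mem_setOf_eq, hφz₀]
    exact hφle z hz
  have hconst := Complex.eqOn_of_isPreconnected_of_isMaxOn_norm (convex_ball c R).isPreconnected
    isOpen_ball hφd hz₀ hmax
  refine ⟨1, fun z hz => ?_⟩
  have h1 : φ z = φ z₀ := hconst hz
  have h2 : l₁ z = φ z * l₀ z := by
    rw [hφ]; exact (div_mul_cancel₀ (l₁ z) (hne z hz)).symm
  rw [h2, norm_mul, h1, hφz₀]

/-! ## COMPOSITION: the two stubs refute the crux BY NAME -/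

/-- COMPOSITION (line `FluxPinchSketch`): `stub_dominance_of_zeroFree` (analysis) and
`stub_fluxVacuaTwoRate` (physics) give `¬ TubeZeroFreeChannel`.  If the crux held, the pinched
disc `ball β δ ⊇ ball β R` would be uniformly zero-free; Harnack's two-rate lemma yields a large
`L` and `z₀` in the disc with `Re g_L(z₀) ≤ 0`, i.e. `‖λ₀(z₀)‖ ≤ ‖λ_{j₀}(z₀)‖`; the analytic stub
(fed with zero-freeness for `t ≥ max t₀ 1`) makes `λ₀` dominate `λ_{j₀}` on the whole disc; the
maximum modulus principle then makes `‖λ_{j₀}‖ = 1·‖λ₀‖` on the disc — excluded by the physics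
stub's non-proportionality clause. -/
theorem TubeZeroFreeChannel_refuted_of : ¬ TubeZeroFreeChannel := by
  obtain ⟨G, _, _, _, _, _, _, hG, r, hr⟩ := stub_fluxVacuaTwoRate
  refine not_tubeZeroFreeChannel_of_pinchedAxis G hG r fun b => ?_
  obtain ⟨β, hb, hβ⟩ := hr b
  refine ⟨β, hb, fun δ hδ hU => ?_⟩
  obtain ⟨R, x, k, n, j₀, lam, Λ, g, L₀, hR, hRδ, hx, hn, hj₀, hL, hrate⟩ := hβ δ hδ
  -- Harnack two-rate: `Re g_L ≤ 0` somewhere in the disc, for cofinally many `L`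
  have hd : ∀ᶠ L in atTop, DifferentiableOn ℂ (g L) (ball (β : ℂ) R) :=
    eventually_atTop.2 ⟨L₀, fun L hLL => (hL L hLL).2.2.2.2.2.2.1⟩
  have hpos : ∀ᶠ L in atTop, 0 < (g L β).re :=
    eventually_atTop.2 ⟨L₀, fun L hLL => (hL L hLL).2.2.2.2.2.2.2.1⟩
  have hfreq := exists_re_nonpos_of_twoRate hR hx hd hpos hrate
  -- unpack the (supposed) uniform zero-freeness of the `δ`-disc
  obtain ⟨L₁, hL₁⟩ := hU
  obtain ⟨L, hLge, z₀, hz₀, hgz₀⟩ := (frequently_atTop.1 hfreq) (max L₀ L₁)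
  have hLL₀ : L₀ ≤ L := le_trans (le_max_left _ _) hLge
  have hLL₁ : L₁ ≤ L := le_trans (le_max_right _ _) hLge
  obtain ⟨hdlam, hlam, henv, hnd, ⟨C, θ, hC, hθ, hθ1, hdom⟩, hstrict, -, -, hfac⟩ := hL L hLL₀
  -- at `z₀` the vacuum level is no longer strictly dominant: `‖λ₀‖ = ‖λ_{j₀}‖ e^{Re g} ≤ ‖λ_{j₀}‖`
  have hloss : ‖lam L 0 z₀‖ ≤ ‖lam L j₀ z₀‖ := by
    rw [hfac z₀ hz₀, norm_mul, Complex.norm_exp]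
    have h1 : Real.exp (g L z₀).re ≤ 1 := by
      rw [← Real.exp_zero]; exact Real.exp_le_exp.mpr hgz₀
    calc ‖lam L j₀ z₀‖ * Real.exp (g L z₀).re ≤ ‖lam L j₀ z₀‖ * 1 :=
          mul_le_mul_of_nonneg_left h1 (norm_nonneg _)
      _ = ‖lam L j₀ z₀‖ := mul_one _
  -- zero-freeness of the tubes of cross-section `L` on `ball β R ⊆ ball β δ` for `t ≥ max t₀ 1`
  obtain ⟨t₀, ht₀⟩ := hL₁ L hLL₁
  set Z : ℕ → ℂ → ℂ := fun t z =>
    (boxSystem r.ρ (![L, L, L, t] : Fin 4 → ℕ)).partZ Finset.univ z with hZdef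
  have hzf : ∀ t, max t₀ 1 ≤ t → ∀ z ∈ ball (β : ℂ) R, Z t z ≠ 0 := by
    intro t ht z hz
    have h := ht₀ t (le_trans (le_max_left _ _) ht) z (ball_subset_ball hRδ hz)
    rwa [Zc_eq_partZ] at h
  have hZd : ∀ t, max t₀ 1 ≤ t → DifferentiableOn ℂ (Z t) (ball (β : ℂ) R) :=
    fun t _ => (differentiable_partZ_box r L t).differentiableOn
  have hdom' : ∀ z ∈ ball (β : ℂ) R, ∀ t : ℕ, max t₀ 1 ≤ t →
      ‖Z t z - ∑ j, (n j : ℂ) * (lam L j z) ^ t‖ ≤ C * (θ * Λ L z) ^ t :=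
    fun z hz t ht => hdom z hz t (le_trans (le_max_right _ _) ht)
  -- STUB A: the vacuum dominates every level on the whole disc
  have hdomAll := stub_dominance_of_zeroFree Z (β : ℂ) R k (lam L) n (Λ L) C θ (max t₀ 1) hR hn
    hC hθ hθ1 hZd hdlam hlam henv hnd hdom' hstrict hzf
  -- maximum modulus: `λ_{j₀}` and `λ₀` are proportional in modulus — excluded
  obtain ⟨a, ha⟩ := norm_eq_const_mul_of_dominated_touch (hdlam 0) (hdlam j₀)
    (fun z hz => (hlam 0 z hz).1) (fun z hz => hdomAll j₀ z hz) hz₀ hloss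
  exact hnd j₀ 0 hj₀ ⟨a, ha⟩

/-- `¬ TubeZeroFreeChannel` under a NAME — the registration handle of this refutation line
(`ledger skeleton check … --crux-decl <this>` audits "a theorem concludes the handle by name modulo
the declared stubs"; the handle is the negated crux by `Iff.rfl`). -/
def NotTubeZeroFreeChannel : Prop := ¬ TubeZeroFreeChannel

/-- The handle IS the negated crux, definitionally. -/
theorem notTubeZeroFreeChannel_iff : NotTubeZeroFreeChannel ↔ ¬ TubeZeroFreeChannel := Iff.rfl

/-- COMPOSITION under the registration handle. -/
theorem NotTubeZeroFreeChannel_of : NotTubeZeroFreeChannel := TubeZeroFreeChannel_refuted_of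

end Summit.QuantumFields.YangMills.Cruxes.TubeZeroFreeChannel.FluxPinch
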